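import Literature.NumberTheory.LFunctions.BurnolSonineZeros
import Literature.NumberTheory.LFunctions.BurnolZetaSystemsHardy
import Literature.NumberTheory.LFunctions.SonineMellinFunctionalEquation
import Literature.NumberTheory.LFunctions.BurnolEvaluatorProofs
import Literature.NumberTheory.LFunctions.BurnolZetaSystemsMinimal
import Literature.Analysis.FunctionSpaces.MellinPlancherelL2
import HarnessLib

/-!
# Burnol 2004b, Lemma 7.4: a non-complete system of evaluators of `K_a` is minimal
# (and: the evaluators of `K_a` at EVERY `(w, k)` exist)

LINE 1 — LABEL: RH-FREE (Hilbert-space / entire-function bookkeeping for the evaluators of de Branges'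
Sonine space `K_a` attached to an ARBITRARY multiset `𝒵 ⊂ ℂ`; the Riemann zeta function does not
occur). FRAMING (cell rh-crit, D-0074): corpus theorems are RH-FREE literature; nothing here is worded as
progress toward RH. bears_on: B-C/B-P (LADDER-RH COLUMN 6, de Branges framework), as the first lemma of
[Burnol2004b] §7 (the root of Thms. 7.1–7.3). WHAT THIS IS NOT: not a route, not a criterion, no
positivity condition at `E_ζ` (Conrey–Li guard); which abstract evaluator systems are minimal in which
`K_a` moves RH by nothing. Nothing here bears on the truth of RH.

Source: J.-F. Burnol, *Two complete and minimal systems associated with the zeros of the Riemann zeta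
function*, J. Théor. Nombres Bordeaux 16 (2004) 65–94 = arXiv:math/0203120v7 (bib key `Burnol2004b`;
TeX of record `dbl/src/Burnol2004JTNB_arXivmath0203120v7.tex`), §7, Lemma 7.4 (p. 18, TeX l.1435–1459):

> "If the system of evaluators associated in a given `K_a` to a (non-empty) multiset `𝒵` is not
> complete, then it is minimal. […] Proof. Let us assume that the system is not complete. Then we have
> a non zero Sonine function `G(s)` in `K̂_a` such that `π^{-s/2}Γ(s/2)G(s)` vanishes on `𝒵`. From the
> proposition [4.3] we know that if `π^{-w/2}Γ(w/2)G(w) = 0` then `G(s)/(s−w)` is again a Sonine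
> function in `K̂_a`. Let us now proceed to take `ρ` in the support of `𝒵`, and divide `G(s)` by powers
> of `(s−ρ)` to construct functions which vanish exactly to the `k`-th order at `ρ`, for
> `0 ≤ k < m_𝒵(ρ)` (this is after incorporating the Gamma factor). From suitable linear combinations we
> construct further an `a`-Sonine function `G_k(s)` whose `l`-th derivative for `0 ≤ l < m_𝒵(ρ)` […]
> vanishes at `ρ`, except for `l = k` for which it does not vanish, and with `G_k(s)` vanishing on the
> remaining part of the multiset `𝒵`. This proves that the evaluators in `K_a` associated with `𝒵` are
> minimal."

The typed statement is `Burnol2004b_lemma7_4` (`BurnolSonineZeros.lean`), over the evaluators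
`sonineZ a w k` / `IsSonineZ a w k` of `K_a` for the bilinear form `[f, g] = ∫₀^∞ fg` and the ENTIRE
completed Mellin transform `𝒢_f = completedMellinEntire f` (junk-free on `K_a` by Thm. 2.1,
`hasCompletedMellinEntire_of_mem_sonineK`).

## What is proved (theorems only; no definition, no named fact) — the printed proof, step by step

§A–§C (the objects of the statement are junk-free): the evaluations `f ↦ 𝒢_f^{(k)}(w)` are LINEAR
(`SonineMultiset.completedMellinEntire_add/_smul`) and BOUNDED on `K_a` at EVERY `w ∈ ℂ`, poles of
`Γ_ℝ` included (`SonineMultiset.exists_bound_iteratedDeriv_completedMellinEntire`: Thm. 2.1's explicit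
`𝒢_f = Γ_ℝ · G_{𝓕f}(1 − ·)` off the poles, the `L²` bound `SonineMellin.exists_bound_sonineMellinExt`, and
Cauchy's estimate on a pole-free circle of radius `1` or `1/2`), hence — Fréchet–Riesz on the closed,
conjugation-stable `K_a`, dbl-t10's engine `BurnolEvaluators.exists_pairing_repr` — **the evaluators
exist: `SonineMultiset.isSonineZ_sonineZ : IsSonineZ a w k (sonineZ a w k)`** (`0 < a`, all `w`, `k`),
and are unique (`IsSonineZ.unique`).
§D ("a non zero Sonine function `G(s)`"): Mellin–Plancherel injectivity on `K_a`,
`SonineMultiset.eq_zero_of_completedMellinEntire_eq_zero` (dbl-t11's `Literature.Analysis.FunctionSpaces.MellinL2.mellinL2` isometry).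
§E ("not complete ⇒ … `π^{-s/2}Γ(s/2)G(s)` vanishes on `𝒵`"): orthogonal projection onto the closed span
inside the closed submodule `K_a = S(a,a)` and conjugation: `SonineMultiset.exists_annihilated`.
§F ("divide `G(s)` by powers of `(s−ρ)`"): the `K_a` clause of Prop. 4.3 (`Burnol2004b_prop4_3R`, taken
as a HYPOTHESIS `SonineMultiset.DivK`-shaped binder — it is dbl row R19c) transported to `𝒢`
(`completedMellinEntire_eq_mul_of_div`) and iterated along the analytic order (`exists_div_pow`).
§G ("suitable linear combinations"): dbl-t6's triangular inversion `BurnolZetaMinimal.exists_dual_functional`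
applied to the continuous pairings `[h_j, ·]` (`BurnolZetaMinimal.exists_pairingCLM`).
§H `SonineMultiset.isMinimalSystem_of_not_isCompleteSystemIn`, and the typed lemma:
**`Burnol2004b_lemma7_4_of_prop4_3R : Burnol2004b_prop4_3R → Burnol2004b_lemma7_4`** (only the `K_a`
clause is used: `Burnol2004b_lemma7_4_of_divK`). The hypothesis-free `Burnol2004b_lemma7_4_holds` is the
one-liner over `Burnol2004b_prop4_3R_holds` once that lands (both clauses of Prop. 4.3 are tree theorems
off the critical line, `SonineDivision.sonineK_div_of_re_ne_half`; the line `Re w = ½` is in progress).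

Deviation from print (said once): none in the mathematics; the "suitable linear combinations" are taken
on the side of the functionals `[h_j, ·]` rather than of the functions `G_k` (the same triangular matrix).

## References
* [Burnol2004b] J.-F. Burnol, JTNB 16 (2004) = arXiv:math/0203120v7, Lemma 7.4 (p. 18, TeX l.1435–1459),
  Thm. 2.1 (p. 5, TeX l.437–443), Prop. 4.3 (p. 8, TeX l.711–731), §7 (p. 17, TeX l.1382–1398).
* Mathlib: `Complex.norm_iteratedDeriv_le_of_forall_mem_sphere_norm_le` (Cauchy's estimate),
  `Submodule.starProjection` (orthogonal projection), `analyticOrderAt_mul`.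
-/

noncomputable section

open MeasureTheory Complex Filter Set FourierTransform
open scoped Topology ENNReal ComplexConjugate InnerProductSpace

namespace Literature.NumberTheory.LFunctions

namespace SonineMultiset

open Literature.Analysis.DeBrangesSpaces.SonineMellin BurnolEvaluators

variable {a : ℝ}

/-! ## A. Linearity of `f ↦ 𝒢_f` on `K_a` -/

/-- The right Mellin transform only depends on the a.e. class. [folklore] -/
private theorem rightMellin_congr_ae {f g : ℝ → ℂ} (h : f =ᵐ[volume] g) (s : ℂ) :
    rightMellin f s = rightMellin g s := by
  simp only [rightMellin, mellin]
  refine integral_congr_ae ?_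
  filter_upwards [ae_restrict_of_ae (s := Ioi (0:ℝ)) h] with t ht
  rw [ht]

/-- `𝒢_f` is entire for `f ∈ K_a` (Thm. 2.1). [cite: Burnol2004b, Thm. 2.1 (arXiv:math/0203120v7 p. 5, TeX l.437–443)] -/
theorem differentiable_completedMellinEntire (ha : 0 < a) {f : Lp ℂ 2 (volume : Measure ℝ)}
    (hf : f ∈ sonineK a) : Differentiable ℂ (completedMellinEntire (f : ℝ → ℂ)) :=
  (hasCompletedMellinEntire_of_mem_sonineK ha hf).1

/-- **Additivity `𝒢_{f+g} = 𝒢_f + 𝒢_g`** on `K_a` (both sides are entire continuations of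
`Γ_ℝ · (f+g)^ = Γ_ℝ f̂ + Γ_ℝ ĝ` from the strip; uniqueness `HasCompletedMellinEntire.eq`).
[cite: Burnol2004b, Thm. 2.1 (arXiv:math/0203120v7 p. 5, TeX l.437–443)] -/
theorem completedMellinEntire_add (ha : 0 < a) {f g : Lp ℂ 2 (volume : Measure ℝ)}
    (hf : f ∈ sonineK a) (hg : g ∈ sonineK a) :
    completedMellinEntire ((f + g : Lp ℂ 2 (volume : Measure ℝ)) : ℝ → ℂ) =
      fun s ↦ completedMellinEntire (f : ℝ → ℂ) s + completedMellinEntire (g : ℝ → ℂ) s := by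
  have hF := hasCompletedMellinEntire_of_mem_sonineK ha hf
  have hG := hasCompletedMellinEntire_of_mem_sonineK ha hg
  have hFG := hasCompletedMellinEntire_of_mem_sonineK ha (add_mem_sonineK hf hg)
  refine hFG.eq ⟨hF.1.add hG.1, fun s hs1 hs2 ↦ ?_⟩
  show completedMellinEntire (f : ℝ → ℂ) s + completedMellinEntire (g : ℝ → ℂ) s = _
  rw [hF.2 s hs1 hs2, hG.2 s hs1 hs2, rightMellin_congr_ae (Lp.coeFn_add f g) s]
  have h := hasMellin_add
    (mellinConvergent_of_mem_sonineL ha (sonineK_subset_sonineL a hf) hs1 hs2)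
    (mellinConvergent_of_mem_sonineL ha (sonineK_subset_sonineL a hg) hs1 hs2)
  rw [rightMellin, rightMellin, rightMellin, ← mul_add, ← h.2]
  rfl

/-- **Homogeneity `𝒢_{c f} = c 𝒢_f`** on `K_a`. [cite: Burnol2004b, Thm. 2.1 (arXiv:math/0203120v7 p. 5, TeX l.437–443)] -/
theorem completedMellinEntire_smul (ha : 0 < a) (c : ℂ) {f : Lp ℂ 2 (volume : Measure ℝ)}
    (hf : f ∈ sonineK a) :
    completedMellinEntire ((c • f : Lp ℂ 2 (volume : Measure ℝ)) : ℝ → ℂ) =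
      fun s ↦ c * completedMellinEntire (f : ℝ → ℂ) s := by
  have hF := hasCompletedMellinEntire_of_mem_sonineK ha hf
  have hcF := hasCompletedMellinEntire_of_mem_sonineK ha (smul_mem_sonineK c hf)
  refine hcF.eq ⟨hF.1.const_mul c, fun s hs1 hs2 ↦ ?_⟩
  show c * completedMellinEntire (f : ℝ → ℂ) s = _
  rw [hF.2 s hs1 hs2, rightMellin_congr_ae (Lp.coeFn_smul c f) s]
  have h := hasMellin_const_smul
    (mellinConvergent_of_mem_sonineL ha (sonineK_subset_sonineL a hf) hs1 hs2) c
  rw [rightMellin, rightMellin, mul_left_comm, ← smul_eq_mul c, ← h.2]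
  rfl

/-- Subtraction: `𝒢_{f−g} = 𝒢_f − 𝒢_g` on `K_a`. [cite: Burnol2004b, Thm. 2.1 (arXiv:math/0203120v7 p. 5, TeX l.437–443)] -/
theorem completedMellinEntire_sub (ha : 0 < a) {f g : Lp ℂ 2 (volume : Measure ℝ)}
    (hf : f ∈ sonineK a) (hg : g ∈ sonineK a) :
    completedMellinEntire ((f - g : Lp ℂ 2 (volume : Measure ℝ)) : ℝ → ℂ) =
      fun s ↦ completedMellinEntire (f : ℝ → ℂ) s - completedMellinEntire (g : ℝ → ℂ) s := by
  have e : (f - g : Lp ℂ 2 (volume : Measure ℝ)) = f + (-1 : ℂ) • g := by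
    rw [sub_eq_add_neg, neg_one_smul]
  rw [e, completedMellinEntire_add ha hf (smul_mem_sonineK _ hg), completedMellinEntire_smul ha _ hg]
  funext s
  ring

/-- Additivity of the evaluation `f ↦ 𝒢_f^{(k)}(w)` on `K_a`. [cite: Burnol2004b, §7 (arXiv:math/0203120v7 p. 17, TeX l.1382–1389)] -/
theorem iteratedDeriv_completedMellinEntire_add (ha : 0 < a) {f g : Lp ℂ 2 (volume : Measure ℝ)}
    (hf : f ∈ sonineK a) (hg : g ∈ sonineK a) (w : ℂ) (k : ℕ) :
    iteratedDeriv k (completedMellinEntire ((f + g : Lp ℂ 2 (volume : Measure ℝ)) : ℝ → ℂ)) w =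
      iteratedDeriv k (completedMellinEntire (f : ℝ → ℂ)) w +
        iteratedDeriv k (completedMellinEntire (g : ℝ → ℂ)) w := by
  rw [completedMellinEntire_add ha hf hg]
  exact iteratedDeriv_fun_add
    (((differentiable_completedMellinEntire ha hf).analyticAt w).contDiffAt)
    (((differentiable_completedMellinEntire ha hg).analyticAt w).contDiffAt)

/-- Homogeneity of the evaluation `f ↦ 𝒢_f^{(k)}(w)` on `K_a`. [cite: Burnol2004b, §7 (arXiv:math/0203120v7 p. 17, TeX l.1382–1389)] -/
theorem iteratedDeriv_completedMellinEntire_smul (ha : 0 < a) (c : ℂ) {f : Lp ℂ 2 (volume : Measure ℝ)}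
    (hf : f ∈ sonineK a) (w : ℂ) (k : ℕ) :
    iteratedDeriv k (completedMellinEntire ((c • f : Lp ℂ 2 (volume : Measure ℝ)) : ℝ → ℂ)) w =
      c * iteratedDeriv k (completedMellinEntire (f : ℝ → ℂ)) w := by
  rw [completedMellinEntire_smul ha c hf]
  exact iteratedDeriv_const_mul c (((differentiable_completedMellinEntire ha hf).analyticAt w).contDiffAt)

/-- Subtraction for the evaluation. [cite: Burnol2004b, §7 (arXiv:math/0203120v7 p. 17, TeX l.1382–1389)] -/
theorem iteratedDeriv_completedMellinEntire_sub (ha : 0 < a) {f g : Lp ℂ 2 (volume : Measure ℝ)}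
    (hf : f ∈ sonineK a) (hg : g ∈ sonineK a) (w : ℂ) (k : ℕ) :
    iteratedDeriv k (completedMellinEntire ((f - g : Lp ℂ 2 (volume : Measure ℝ)) : ℝ → ℂ)) w =
      iteratedDeriv k (completedMellinEntire (f : ℝ → ℂ)) w -
        iteratedDeriv k (completedMellinEntire (g : ℝ → ℂ)) w := by
  have e : (f - g : Lp ℂ 2 (volume : Measure ℝ)) = f + (-1 : ℂ) • g := by
    rw [sub_eq_add_neg, neg_one_smul]
  rw [e, iteratedDeriv_completedMellinEntire_add ha hf (smul_mem_sonineK _ hg),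
    iteratedDeriv_completedMellinEntire_smul ha _ hg]
  ring

/-! ## B. The evaluations `f ↦ 𝒢_f^{(k)}(w)` are bounded on `K_a` at EVERY `w` -/

/-- `Γ_ℝ` is differentiable off its poles (`1/Γ_ℝ` is entire). [folklore] -/
private theorem differentiableAt_Gammaℝ {s : ℂ} (hs : Gammaℝ s ≠ 0) : DifferentiableAt ℂ Gammaℝ s := by
  have h := (differentiable_Gammaℝ_inv s).inv (inv_ne_zero hs)
  refine h.congr_of_eventuallyEq (Eventually.of_forall fun z ↦ ?_)
  simp

/-- Around every `w ∈ ℂ` there is a circle of radius `1` or `1/2` avoiding the poles `0, −2, −4, …` of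
`Γ_ℝ` (two poles are at distance `≥ 2`). [folklore] -/
private theorem exists_sphere_Gammaℝ_ne_zero (w : ℂ) :
    ∃ r : ℝ, 0 < r ∧ r ≤ 1 ∧ ∀ z ∈ Metric.sphere w r, Gammaℝ z ≠ 0 := by
  by_cases h1 : ∀ z ∈ Metric.sphere w 1, Gammaℝ z ≠ 0
  · exact ⟨1, one_pos, le_rfl, h1⟩
  · push Not at h1
    obtain ⟨z₁, hz₁, hΓ₁⟩ := h1
    refine ⟨1 / 2, by norm_num, by norm_num, fun z hz hΓ ↦ ?_⟩
    obtain ⟨m, hm⟩ := Gammaℝ_eq_zero_iff.mp hΓ₁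
    obtain ⟨n, hn⟩ := Gammaℝ_eq_zero_iff.mp hΓ
    rw [Metric.mem_sphere, dist_eq_norm] at hz₁ hz
    have hd : ‖z₁ - z‖ ≤ 3 / 2 := by
      calc ‖z₁ - z‖ = ‖(z₁ - w) - (z - w)‖ := by ring_nf
        _ ≤ ‖z₁ - w‖ + ‖z - w‖ := norm_sub_le _ _
        _ = 3 / 2 := by rw [hz₁, hz]; norm_num
    have hint : z₁ - z = (((2 * ((n : ℤ) - m) : ℤ)) : ℂ) := by rw [hm, hn]; push_cast; ring
    rw [hint, Complex.norm_intCast] at hd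
    obtain ⟨hd₁, hd₂⟩ := abs_le.mp hd
    have h2 : (2 * ((n : ℤ) - m) : ℤ) < 2 := by
      have : ((2 * ((n : ℤ) - m) : ℤ) : ℝ) < 2 := by linarith
      exact_mod_cast this
    have h3 : (-2 : ℤ) < 2 * ((n : ℤ) - m) := by
      have : (-2 : ℝ) < ((2 * ((n : ℤ) - m) : ℤ) : ℝ) := by linarith
      exact_mod_cast this
    have hmn : (n : ℤ) = m := by omega
    have hzz : z₁ = z := by
      rw [← sub_eq_zero, hint, hmn]
      push_cast
      ring
    rw [hzz, hz] at hz₁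
    norm_num at hz₁

/-- **Continuity of the evaluations at every point (Thm. 2.1, derivatives included).** For `0 < a`,
`w ∈ ℂ` and `k ∈ ℕ` there is `C` with `‖𝒢_f^{(k)}(w)‖ ≤ C‖f‖` for all `f ∈ K_a`: on a pole-free circle
`|z − w| = r ∈ {1, ½}` the entire `𝒢_f` is `Γ_ℝ(z)·G_{𝓕f}(1−z)` with `‖G_{𝓕f}(1−z)‖ ≤ C(a,‖w‖+2)‖𝓕f‖
= C‖f‖` (Plancherel), and Cauchy's estimate bounds the `k`-th derivative at the centre ("The evaluations
at complex numbers `w ∈ ℂ` are continuous linear forms on `K_a`").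
[cite: Burnol2004b, Thm. 2.1 (arXiv:math/0203120v7 p. 5, TeX l.437–443)] -/
theorem exists_bound_iteratedDeriv_completedMellinEntire (ha : 0 < a) (w : ℂ) (k : ℕ) :
    ∃ C : ℝ, ∀ f ∈ sonineK a,
      ‖iteratedDeriv k (completedMellinEntire (f : ℝ → ℂ)) w‖ ≤ C * ‖f‖ := by
  obtain ⟨r, hr0, hr1, hsphere⟩ := exists_sphere_Gammaℝ_ne_zero w
  have hcont : ContinuousOn Gammaℝ (Metric.sphere w r) := fun z hz ↦
    (differentiableAt_Gammaℝ (hsphere z hz)).continuousAt.continuousWithinAt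
  obtain ⟨B, hB⟩ := (isCompact_sphere w r).exists_bound_of_continuousOn hcont
  obtain ⟨C₂, hC₂0, hC₂⟩ := exists_bound_sonineMellinExt ha ha (‖w‖ + 2)
  refine ⟨(k.factorial : ℝ) * (max B 0 * C₂) / r ^ k, fun f hf ↦ ?_⟩
  have hM := differentiable_completedMellinEntire ha hf
  have hbound : ∀ z ∈ Metric.sphere w r,
      ‖completedMellinEntire (f : ℝ → ℂ) z‖ ≤ max B 0 * C₂ * ‖f‖ := by
    intro z hz
    rw [completedMellinEntire_eq_Gammaℝ_mul_of_mem_sonineK ha hf (hsphere z hz), norm_mul, mul_assoc]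
    refine mul_le_mul ((hB z hz).trans (le_max_left _ _)) ?_ (norm_nonneg _) (le_max_right _ _)
    have hz' : ‖1 - z‖ ≤ ‖w‖ + 2 := by
      have h1 : ‖z - w‖ = r := by rw [← dist_eq_norm]; exact hz
      calc ‖1 - z‖ ≤ ‖(1 : ℂ)‖ + ‖z‖ := norm_sub_le _ _
        _ = ‖(z - w) + w‖ + 1 := by simp [add_comm]
        _ ≤ (‖z - w‖ + ‖w‖) + 1 := by gcongr; exact norm_add_le _ _
        _ ≤ ‖w‖ + 2 := by rw [h1]; linarith
    calc ‖sonineMellinExt a a ((𝓕 f : Lp ℂ 2 (volume : Measure ℝ)) : ℝ → ℂ) (1 - z)‖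
        ≤ C₂ * ‖(𝓕 f : Lp ℂ 2 (volume : Measure ℝ))‖ := hC₂ _ _ hz'
      _ = C₂ * ‖f‖ := by rw [Lp.norm_fourier_eq]
  have h := Complex.norm_iteratedDeriv_le_of_forall_mem_sphere_norm_le k hr0 hM.diffContOnCl hbound
  calc ‖iteratedDeriv k (completedMellinEntire (f : ℝ → ℂ)) w‖
      ≤ (k.factorial : ℝ) * (max B 0 * C₂ * ‖f‖) / r ^ k := h
    _ = (k.factorial : ℝ) * (max B 0 * C₂) / r ^ k * ‖f‖ := by ring

/-! ## C. The evaluators of `K_a` exist at every `(w, k)`; they are unique -/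

/-- **The evaluators exist (Thm. 2.1 + Fréchet–Riesz for `[f,g] = ∫₀^∞ fg`).** For `0 < a` and every
`w ∈ ℂ`, `k ∈ ℕ` there is `Z ∈ K_a` with `∫₀^∞ f·Z = 𝒢_f^{(k)}(w)` for all `f ∈ K_a` ("the associated
evaluators … in a Sonine space `K_a`"). [cite: Burnol2004b, Thm. 2.1 and §7 (arXiv:math/0203120v7 pp. 5, 17; TeX l.437–443, 1382–1389)] -/
theorem exists_isSonineZ (ha : 0 < a) (w : ℂ) (k : ℕ) :
    ∃ Z : Lp ℂ 2 (volume : Measure ℝ), IsSonineZ a w k Z := by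
  obtain ⟨Z, hZS, hZ⟩ := exists_pairing_repr (isClosed_sonineK a) (zero_mem_sonineK a)
    (fun _ hf _ hg ↦ add_mem_sonineK hf hg) (fun c _ hf ↦ smul_mem_sonineK c hf)
    (fun _ hf ↦ hf.1) (fun _ hu _ hv ↦ mem_sonineK_of_conj hu hv)
    (fun f ↦ iteratedDeriv k (completedMellinEntire (f : ℝ → ℂ)) w)
    (fun _ hf _ hg ↦ iteratedDeriv_completedMellinEntire_add ha hf hg w k)
    (fun c _ hf ↦ iteratedDeriv_completedMellinEntire_smul ha c hf w k)
    (exists_bound_iteratedDeriv_completedMellinEntire ha w k)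
  exact ⟨Z, hZS, hZ⟩

/-- **The `ε`-chosen evaluator `sonineZ a w k` IS the evaluator of `K_a` at `(w, k)`** (`0 < a`; every
`w`, poles of `Γ_ℝ` included, every `k`). [cite: Burnol2004b, §7 (arXiv:math/0203120v7 p. 17, TeX l.1382–1389)] -/
theorem isSonineZ_sonineZ (ha : 0 < a) (w : ℂ) (k : ℕ) : IsSonineZ a w k (sonineZ a w k) :=
  Classical.epsilon_spec (exists_isSonineZ ha w k)

/-- Every vector of the system of evaluators attached to a multiset `𝒵` has its defining property.
[cite: Burnol2004b, §7 (arXiv:math/0203120v7 p. 17, TeX l.1382–1389)] -/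
theorem isSonineZ_sonineZSystem (ha : 0 < a) (Z : ℂ → ℕ) (p : MultisetIndex Z) :
    IsSonineZ a p.1.1 p.1.2 (sonineZSystem a Z p) :=
  isSonineZ_sonineZ ha p.1.1 p.1.2

/-- The vectors of the system lie in `K_a`. [cite: Burnol2004b, §7 (arXiv:math/0203120v7 p. 17, TeX l.1382–1389)] -/
theorem sonineZSystem_mem_sonineK (ha : 0 < a) (Z : ℂ → ℕ) (p : MultisetIndex Z) :
    sonineZSystem a Z p ∈ sonineK a :=
  (isSonineZ_sonineZSystem ha Z p).1

/-- The reproducing identity `[f, Z_{w,k}] = 𝒢_f^{(k)}(w)` on `K_a`. [cite: Burnol2004b, §7 (arXiv:math/0203120v7 p. 17, TeX l.1382–1389)] -/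
theorem setIntegral_mul_sonineZ (ha : 0 < a) (w : ℂ) (k : ℕ) {f : Lp ℂ 2 (volume : Measure ℝ)}
    (hf : f ∈ sonineK a) :
    ∫ t in Ioi (0 : ℝ), f t * sonineZ a w k t = iteratedDeriv k (completedMellinEntire (f : ℝ → ℂ)) w :=
  (isSonineZ_sonineZ ha w k).2 f hf

/-! ## D. "A non zero Sonine function `G(s)`": `f ↦ 𝒢_f` is injective on `K_a` -/

/-- If `𝒢_f ≡ 0` (`f ∈ K_a`) then `∫₀^∞ f(t)t^{z−1}dt = 0` on the whole half-plane `Re z < ½` of absolute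
convergence: on the strip `0 < Re z < ½` this is `Γ_ℝ(1−z)f̂(1−z) = 𝒢_f(1−z) = 0` with `Γ_ℝ ≠ 0`, and
the transform is holomorphic on the half-plane (`SonineMellin.differentiableOn_mellin`, identity theorem).
[cite: Burnol2004b, Thm. 2.1 (arXiv:math/0203120v7 p. 5, TeX l.437–443); Burnol2001CRAS, §1 (TeX l.288–290)] -/
theorem mellin_eq_zero_of_completedMellinEntire_eq_zero (ha : 0 < a) {f : Lp ℂ 2 (volume : Measure ℝ)}
    (hf : f ∈ sonineK a) (h : ∀ s, completedMellinEntire (f : ℝ → ℂ) s = 0) {z : ℂ}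
    (hz : z.re < 1 / 2) : mellin (f : ℝ → ℂ) z = 0 := by
  have hfa := (sonineK_subset_soninSpace a hf).2.1
  have hD := differentiableOn_mellin ha f hfa
  have hUo : IsOpen {w : ℂ | w.re < 1 / 2} := isOpen_lt Complex.continuous_re continuous_const
  have hUc : IsPreconnected {w : ℂ | w.re < 1 / 2} := (convex_halfSpace_re_lt (1 / 2 : ℝ)).isPreconnected
  have hA : AnalyticOnNhd ℂ (mellin (f : ℝ → ℂ)) {w : ℂ | w.re < 1 / 2} := hD.analyticOnNhd hUo
  -- vanishing on the open strip `0 < Re z < 1/2`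
  have hstrip : ∀ z : ℂ, 0 < z.re → z.re < 1 / 2 → mellin (f : ℝ → ℂ) z = 0 := by
    intro z h0 h1
    have hG := hasCompletedMellinEntire_of_mem_sonineK ha hf
    have hs1 : 1 / 2 < (1 - z).re := by simp only [sub_re, one_re]; linarith
    have hs2 : (1 - z).re < 1 := by simp only [sub_re, one_re]; linarith
    have e := hG.2 (1 - z) hs1 hs2
    rw [h, rightMellin, sub_sub_cancel] at e
    have hΓ : Gammaℝ (1 - z) ≠ 0 := Gammaℝ_ne_zero_of_re_pos (by linarith)
    exact (mul_eq_zero.mp e.symm).resolve_left hΓ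
  have z₀mem : (1 / 4 : ℂ) ∈ {w : ℂ | w.re < 1 / 2} := by
    simp only [mem_setOf_eq]; norm_num
  have hev : mellin (f : ℝ → ℂ) =ᶠ[𝓝 (1 / 4 : ℂ)] 0 := by
    have hO : IsOpen {w : ℂ | 0 < w.re ∧ w.re < 1 / 2} :=
      (isOpen_lt continuous_const Complex.continuous_re).inter
        (isOpen_lt Complex.continuous_re continuous_const)
    have hmem : (1 / 4 : ℂ) ∈ {w : ℂ | 0 < w.re ∧ w.re < 1 / 2} := by
      simp only [mem_setOf_eq]; norm_num
    filter_upwards [hO.mem_nhds hmem] with w hw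
    exact hstrip w hw.1 hw.2
  exact hA.eqOn_zero_of_preconnected_of_eventuallyEq_zero hUc z₀mem hev hz

/-- An a.e. even class vanishing a.e. on `(0, ∞)` is `0`. [folklore] -/
private theorem eq_zero_of_even_of_ae_zero_Ioi {f : Lp ℂ 2 (volume : Measure ℝ)} (heven : f ∈ evenL2)
    (h : ∀ᵐ t : ℝ, t ∈ Ioi (0 : ℝ) → (f : ℝ → ℂ) t = 0) : f = 0 := by
  refine Lp.ext ?_
  have hq : Measure.QuasiMeasurePreserving (fun x : ℝ ↦ -x) volume volume :=
    (Measure.measurePreserving_neg (volume : Measure ℝ)).quasiMeasurePreserving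
  have h' := hq.ae h
  have h0 : ∀ᵐ t : ℝ, t ≠ 0 := by
    have : (volume : Measure ℝ) {t | ¬ t ≠ 0} = 0 := by simp
    exact ae_iff.2 this
  have hev : ∀ᵐ x : ℝ, (f : ℝ → ℂ) (-x) = (f : ℝ → ℂ) x := heven
  filter_upwards [h, h', h0, hev, Lp.coeFn_zero ℂ 2 (volume : Measure ℝ)] with t h1 h2 h3 h4 h5
  rw [h5, Pi.zero_apply]
  rcases lt_or_gt_of_ne h3 with ht | ht
  · rw [← h4]
    exact h2 (show (0 : ℝ) < -t by linarith)
  · exact h1 ht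

/-- **Mellin–Plancherel injectivity on `K_a`** ("a non zero Sonine function `G(s)`"): `f ∈ K_a` with
`𝒢_f ≡ 0` is `0`. Road: `f̂ ≡ 0` on `Re z < ½` (`mellin_eq_zero_of_completedMellinEntire_eq_zero`); the
`L²(0,∞)` function `g(t) = t^{−1/2}f(t)` has absolutely convergent Mellin transform on the critical line
with `𝓜g(½ + iy) = f̂(iy) = 0`, so dbl-t11's Mellin–Plancherel isometry `Literature.Analysis.FunctionSpaces.MellinL2.mellinL2` kills `g`,
hence `f = 0` a.e. on `(0,∞)`, hence everywhere (evenness).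
[cite: Burnol2004b, §1 (arXiv:math/0203120v7 p. 4, TeX l.350–355) and Thm. 2.1 (p. 5, TeX l.437–443)] -/
theorem eq_zero_of_completedMellinEntire_eq_zero (ha : 0 < a) {f : Lp ℂ 2 (volume : Measure ℝ)}
    (hf : f ∈ sonineK a) (h : ∀ s, completedMellinEntire (f : ℝ → ℂ) s = 0) : f = 0 := by
  have hmel : ∀ z : ℂ, z.re < 1 / 2 → mellin (f : ℝ → ℂ) z = 0 :=
    fun z hz ↦ mellin_eq_zero_of_completedMellinEntire_eq_zero ha hf h hz
  obtain ⟨heven, hfa, -⟩ := sonineK_subset_soninSpace a hf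
  -- `g(t) = t^{-1/2} f(t)` on `(0,∞)`
  set g : ℝ → ℂ := fun t ↦ (t : ℂ) ^ (-(1 / 2 : ℂ)) • (f : ℝ → ℂ) t with hg
  have hf2 : MemLp (f : ℝ → ℂ) 2 (volume.restrict (Ioi (0:ℝ))) := (Lp.memLp f).restrict _
  have hg_meas : AEStronglyMeasurable g (volume.restrict (Ioi (0:ℝ))) := by
    have hc : AEStronglyMeasurable (fun t : ℝ ↦ (t : ℂ) ^ (-(1 / 2 : ℂ))) (volume.restrict (Ioi (0:ℝ))) := by
      refine (ContinuousOn.aestronglyMeasurable (fun t ht ↦ ?_) measurableSet_Ioi)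
      exact (continuousAt_ofReal_cpow_const _ _ (Or.inr (ne_of_gt ht))).continuousWithinAt
    exact hc.smul hf2.1
  have hg2 : MemLp g 2 (volume.restrict (Ioi (0:ℝ))) := by
    refine MemLp.of_le_mul hf2 (c := a ^ (-(1 / 2 : ℝ))) hg_meas ?_
    rw [ae_restrict_iff' measurableSet_Ioi]
    filter_upwards [hfa] with t hft ht
    have ht0 : (0 : ℝ) < t := ht
    by_cases hta : t ≤ a
    · have hz : (f : ℝ → ℂ) t = 0 := hft ⟨by linarith, hta⟩
      simp [hg, hz]
    · push Not at hta
      rw [hg, norm_smul, norm_cpow_eq_rpow_re_of_pos ht0]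
      have hre : (-(1 / 2 : ℂ)).re = -(1 / 2 : ℝ) := by simp
      rw [hre]
      gcongr ?_ * ‖(f : ℝ → ℂ) t‖
      exact Real.rpow_le_rpow_of_nonpos ha hta.le (by norm_num)
  -- absolute convergence of `𝓜g` on the critical line: `t^{1/2-1}g = t^{-1}f`, zero on `(0,a]`,
  -- integrable on `(a,∞)` by Cauchy–Schwarz
  have hg1 : MellinConvergent g (1 / 2 : ℂ) := by
    rw [hg, MellinConvergent.cpow_smul]
    have e : (1 / 2 : ℂ) + -(1 / 2 : ℂ) = 0 := by ring
    rw [e, MellinConvergent, ← Ioc_union_Ioi_eq_Ioi ha.le]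
    refine IntegrableOn.union ?_ ?_
    · have h0 : IntegrableOn (fun _ : ℝ ↦ (0 : ℂ)) (Ioc (0:ℝ) a) volume := integrableOn_zero
      refine h0.congr_fun_ae ?_
      rw [EventuallyEq, ae_restrict_iff' measurableSet_Ioc]
      filter_upwards [hfa] with t hft ht
      rw [hft ⟨by linarith [ht.1], ht.2⟩, smul_zero]
    · have h1 := BurnolTailAvg.integrableOn_cpow_mul ha (Lp.memLp f) (s := 1)
        (by simp only [one_re]; norm_num)
      refine h1.congr_fun (fun t _ ↦ ?_) measurableSet_Ioi
      rw [smul_eq_mul, zero_sub]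
  -- `𝓜g = 0` in `L²(ℝ)`
  have hM : Literature.Analysis.FunctionSpaces.MellinL2.mellinL2 (hg2.toLp g) = 0 := by
    refine Lp.ext ?_
    filter_upwards [Literature.Analysis.FunctionSpaces.MellinL2.mellinL2_toLp_ae_eq_mellin hg2 hg1,
      Lp.coeFn_zero ℂ 2 (volume : Measure ℝ)] with ξ h1 h2
    rw [h1, h2, Pi.zero_apply, hg, mellin_cpow_smul, hmel]
    simp only [add_re, one_div, inv_re, re_ofNat, normSq_ofNat, mul_re, ofReal_re, ofReal_im,
      I_re, I_im, neg_re]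
    norm_num
  have hg0 : hg2.toLp g = 0 := by
    have := Literature.Analysis.FunctionSpaces.MellinL2.mellinL2.map_eq_zero_iff (x := hg2.toLp g)
    exact this.mp hM
  -- hence `f = 0` a.e. on `(0,∞)`
  have hgae : g =ᵐ[volume.restrict (Ioi (0:ℝ))] 0 := by
    have h1 := hg2.coeFn_toLp
    rw [hg0] at h1
    exact (h1.symm.trans (Lp.coeFn_zero ℂ 2 _)).trans (by rfl)
  have hfae : ∀ᵐ t : ℝ, t ∈ Ioi (0:ℝ) → (f : ℝ → ℂ) t = 0 := by
    rw [← ae_restrict_iff' measurableSet_Ioi]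
    filter_upwards [hgae, ae_restrict_mem measurableSet_Ioi] with t ht ht0
    have ht0' : (0 : ℝ) < t := ht0
    have hne : (t : ℂ) ^ (-(1 / 2 : ℂ)) ≠ 0 :=
      cpow_ne_zero_iff_of_exponent_ne_zero (by norm_num) |>.mpr (ofReal_ne_zero.mpr ht0'.ne')
    have := ht
    simp only [hg, Pi.zero_apply, smul_eq_zero] at this
    exact this.resolve_left hne
  exact eq_zero_of_even_of_ae_zero_Ioi heven hfae

/-! ## E. "Not complete ⇒ a non-zero Sonine function whose `𝒢` vanishes on `𝒵`" -/

/-- **The starting point of the printed proof.** If the evaluators attached to `𝒵` are NOT complete in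
`K_a` (`0 < a`), there is `f₀ ∈ K_a`, `f₀ ≠ 0`, with `𝒢_{f₀}^{(k)}(w) = 0` for every index `(w, k)` of `𝒵`
("Then we have a non zero Sonine function `G(s)` in `K̂_a` such that `π^{-s/2}Γ(s/2)G(s)` vanishes on
`𝒵`"): take `f ∈ K_a` outside the closed span `V` of the evaluators, `g = f − P_V f ≠ 0` (`V ⊆ K_a`, a
closed subspace, so `g ∈ K_a`), `g ⊥ Z_{w,k}`, and `f₀ = 2ḡ`: `[f₀, Z_{w,k}] = ⟪g, Z_{w,k}⟫ = 0`.
[cite: Burnol2004b, Lemma 7.4, proof (arXiv:math/0203120v7 p. 18, TeX l.1440–1443)] -/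
theorem exists_annihilated (ha : 0 < a) (Z : ℂ → ℕ)
    (hnc : ¬ IsCompleteSystemIn (sonineK a) (sonineZSystem a Z)) :
    ∃ f₀ ∈ sonineK a, f₀ ≠ 0 ∧
      ∀ p : MultisetIndex Z,
        iteratedDeriv p.1.2 (completedMellinEntire (f₀ : ℝ → ℂ)) p.1.1 = 0 := by
  set u := sonineZSystem a Z with hu
  have hmem : ∀ p, u p ∈ sonineK a := sonineZSystem_mem_sonineK ha Z
  -- a vector of `K_a` outside the closed span
  have hnot : ¬ (sonineK a ⊆
      closure (Submodule.span ℂ (Set.range u) : Set (Lp ℂ 2 (volume : Measure ℝ)))) :=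
    fun hsub ↦ hnc ⟨hmem, hsub⟩
  obtain ⟨f, hfK, hfV⟩ := Set.not_subset.mp hnot
  -- `K_a` as a closed submodule (Connes–Consani's `S(a,a)`) and the closed span `V ≤ K_a`
  set K : Submodule ℂ (Lp ℂ 2 (volume : Measure ℝ)) :=
    Literature.NumberTheory.ConnesConsani2021.soninSpace a a with hK
  have hKeq : sonineK a = (K : Set (Lp ℂ 2 (volume : Measure ℝ))) := sonineK_eq_soninSpace a
  have hKc : IsClosed (K : Set (Lp ℂ 2 (volume : Measure ℝ))) := by
    rw [← hKeq]; exact isClosed_sonineK a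
  set V : Submodule ℂ (Lp ℂ 2 (volume : Measure ℝ)) :=
    (Submodule.span ℂ (Set.range u)).topologicalClosure with hV
  have hVcoe : (V : Set (Lp ℂ 2 (volume : Measure ℝ))) =
      closure (Submodule.span ℂ (Set.range u) : Set (Lp ℂ 2 (volume : Measure ℝ))) :=
    Submodule.topologicalClosure_coe _
  haveI : CompleteSpace V := (Submodule.isClosed_topologicalClosure _).completeSpace_coe
  have hspanK : Submodule.span ℂ (Set.range u) ≤ K := by
    refine Submodule.span_le.mpr ?_
    rintro _ ⟨p, rfl⟩
    show u p ∈ (K : Set (Lp ℂ 2 (volume : Measure ℝ)))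
    rw [← hKeq]
    exact hmem p
  have hVK : V ≤ K :=
    (Submodule.topologicalClosure_mono hspanK).trans (le_of_eq (hKc.submodule_topologicalClosure_eq))
  have huV : ∀ p, u p ∈ V := fun p ↦
    Submodule.le_topologicalClosure _ (Submodule.subset_span ⟨p, rfl⟩)
  -- `g = f − P_V f`
  set g : Lp ℂ 2 (volume : Measure ℝ) := f - V.starProjection f with hg
  have hfK' : f ∈ K := by
    show f ∈ (K : Set (Lp ℂ 2 (volume : Measure ℝ)))
    rw [← hKeq]; exact hfK
  have hgK : g ∈ sonineK a := by
    rw [hKeq]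
    exact K.sub_mem hfK' (hVK (V.starProjection_apply_mem f))
  have hg0 : g ≠ 0 := by
    intro h0
    apply hfV
    have hfV' : f ∈ V := by
      have : f = V.starProjection f := (sub_eq_zero.mp h0)
      rw [this]; exact V.starProjection_apply_mem f
    rw [← hVcoe]
    exact hfV'
  have horth : ∀ p, inner ℂ g (u p) = 0 := fun p ↦
    Submodule.starProjection_inner_eq_zero f (u p) (huV p)
  -- `f₀ = 2 ḡ`
  obtain ⟨v, hv⟩ := exists_conj g
  have hvK : v ∈ sonineK a := mem_sonineK_of_conj hgK hv
  refine ⟨(2 : ℂ) • v, smul_mem_sonineK 2 hvK, fun h0 ↦ ?_, fun p ↦ ?_⟩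
  · -- `2 v = 0 ⇒ v = 0 ⇒ ḡ = 0 ⇒ g = 0`
    have hv0 : v = 0 := by
      rcases smul_eq_zero.mp h0 with h | h
      · exact absurd h two_ne_zero
      · exact h
    apply hg0
    refine Lp.ext ?_
    have h1 : (v : ℝ → ℂ) =ᵐ[volume] 0 := by
      rw [hv0]; exact Lp.coeFn_zero ℂ 2 (volume : Measure ℝ)
    filter_upwards [hv, h1, Lp.coeFn_zero ℂ 2 (volume : Measure ℝ)] with t ht1 ht2 ht3
    rw [ht3, Pi.zero_apply]
    have : conj ((g : ℝ → ℂ) t) = 0 := by rw [← ht1, ht2, Pi.zero_apply]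
    simpa using this
  · have e1 := inner_eq_setIntegral_Ioi hgK.1 (hmem p).1 hv
    rw [horth p] at e1
    rw [← (isSonineZ_sonineZSystem ha Z p).2 _ (smul_mem_sonineK 2 hvK), e1]
    exact integral_congr_ae (Eventually.of_forall fun t ↦ mul_comm _ _)

/-! ## F. "Divide `G(s)` by powers of `(s − ρ)`": Prop. 4.3 (`K_a` clause) on the entire transforms -/

/-- **One division step, read on `𝒢`.** If `f, h ∈ K_a`, `𝒢_f(w) = 0` and `ĥ(s) = f̂(s)/(s − w)` on the
strip (off `s = w`) — the conclusion of Prop. 4.3 — then `𝒢_f(s) = (s − w)·𝒢_h(s)` for EVERY `s ∈ ℂ`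
(both sides are entire continuations of `Γ_ℝ f̂` from the strip; at `s = w` the hypothesis `𝒢_f(w) = 0`
is used). [cite: Burnol2004b, Prop. 4.3 (arXiv:math/0203120v7 p. 8, TeX l.711–731) and Lemma 7.4, proof (p. 18, TeX l.1443–1449)] -/
theorem completedMellinEntire_eq_mul_of_div (ha : 0 < a) {f h : Lp ℂ 2 (volume : Measure ℝ)}
    (hf : f ∈ sonineK a) (hh : h ∈ sonineK a) {w : ℂ} (hw : completedMellinEntire (f : ℝ → ℂ) w = 0)
    (hdiv : ∀ s : ℂ, 1 / 2 < s.re → s.re < 1 → s ≠ w →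
      rightMellin (h : ℝ → ℂ) s = rightMellin (f : ℝ → ℂ) s / (s - w)) :
    ∀ s, completedMellinEntire (f : ℝ → ℂ) s = (s - w) * completedMellinEntire (h : ℝ → ℂ) s := by
  have hF := hasCompletedMellinEntire_of_mem_sonineK ha hf
  have hH := hasCompletedMellinEntire_of_mem_sonineK ha hh
  have key : HasCompletedMellinEntire (f : ℝ → ℂ)
      (fun s ↦ (s - w) * completedMellinEntire (h : ℝ → ℂ) s) := by
    refine ⟨(differentiable_id.sub (differentiable_const w)).mul hH.1, fun s hs1 hs2 ↦ ?_⟩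
    by_cases hsw : s = w
    · subst hsw
      show (s - s) * completedMellinEntire (h : ℝ → ℂ) s = _
      rw [sub_self, zero_mul, ← hF.2 s hs1 hs2, hw]
    · show (s - w) * completedMellinEntire (h : ℝ → ℂ) s = _
      have hne : s - w ≠ 0 := sub_ne_zero.mpr hsw
      rw [hH.2 s hs1 hs2, hdiv s hs1 hs2 hsw]
      field_simp
  exact fun s ↦ congrFun (hF.eq key) s

/-- Order bookkeeping at the division point: `ord_w((s−w)^n·H) = n + ord_w H`. [folklore] -/
private theorem analyticOrderAt_pow_mul_self {H : ℂ → ℂ} {w : ℂ} (hH : AnalyticAt ℂ H w) (n : ℕ) :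
    analyticOrderAt (fun s ↦ (s - w) ^ n * H s) w = n + analyticOrderAt H w := by
  have h1 : AnalyticAt ℂ (fun s : ℂ ↦ (s - w) ^ n) w := (analyticAt_id.sub analyticAt_const).pow n
  have e : (fun s ↦ (s - w) ^ n * H s) = (fun s : ℂ ↦ (s - w) ^ n) * H := rfl
  rw [e, analyticOrderAt_mul h1 hH]
  congr 1
  have : (fun s : ℂ ↦ (s - w) ^ n) = (· - w) ^ n := rfl
  rw [this, analyticOrderAt_centeredMonomial]

/-- Order bookkeeping away from the division point: `ord_z((s−w)^n·H) = ord_z H` for `z ≠ w`. [folklore] -/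
private theorem analyticOrderAt_pow_mul_of_ne {H : ℂ → ℂ} {w z : ℂ} (hH : AnalyticAt ℂ H z) (hz : z ≠ w)
    (n : ℕ) : analyticOrderAt (fun s ↦ (s - w) ^ n * H s) z = analyticOrderAt H z := by
  have h1 : AnalyticAt ℂ (fun s : ℂ ↦ (s - w) ^ n) z := (analyticAt_id.sub analyticAt_const).pow n
  have e : (fun s ↦ (s - w) ^ n * H s) = (fun s : ℂ ↦ (s - w) ^ n) * H := rfl
  rw [e, analyticOrderAt_mul h1 hH, (h1.analyticOrderAt_eq_zero).mpr (pow_ne_zero n (sub_ne_zero.mpr hz)),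
    zero_add]

/-- **Iterated division** ("divide `G(s)` by powers of `(s−ρ)`"): under the `K_a` clause of Prop. 4.3
at level `a`, for `f ∈ K_a` and `n ≤ ord_w 𝒢_f` there is `h ∈ K_a` with `𝒢_f = (s − w)^n · 𝒢_h`.
[cite: Burnol2004b, Lemma 7.4, proof (arXiv:math/0203120v7 p. 18, TeX l.1443–1449)] -/
theorem exists_div_pow (ha : 0 < a)
    (hdivK : ∀ f ∈ sonineK a, ∀ w : ℂ, completedMellinEntire f w = 0 →
      ∃ h ∈ sonineK a, ∀ s : ℂ, 1 / 2 < s.re → s.re < 1 → s ≠ w →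
        rightMellin h s = rightMellin f s / (s - w))
    {f : Lp ℂ 2 (volume : Measure ℝ)} (hf : f ∈ sonineK a) (w : ℂ) :
    ∀ n : ℕ, (n : ℕ∞) ≤ analyticOrderAt (completedMellinEntire (f : ℝ → ℂ)) w →
      ∃ h ∈ sonineK a, ∀ s,
        completedMellinEntire (f : ℝ → ℂ) s = (s - w) ^ n * completedMellinEntire (h : ℝ → ℂ) s
  | 0, _ => ⟨f, hf, fun s ↦ by simp⟩
  | n + 1, hn => by
      obtain ⟨h, hh, hfh⟩ := exists_div_pow ha hdivK hf w n
        (le_trans (by exact_mod_cast n.le_succ) hn)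
      have hHan : AnalyticAt ℂ (completedMellinEntire (h : ℝ → ℂ)) w :=
        (differentiable_completedMellinEntire ha hh).analyticAt w
      -- `ord_w 𝒢_f = n + ord_w 𝒢_h ≥ n + 1`, so `𝒢_h(w) = 0`
      have hord : analyticOrderAt (completedMellinEntire (f : ℝ → ℂ)) w =
          n + analyticOrderAt (completedMellinEntire (h : ℝ → ℂ)) w := by
        rw [show completedMellinEntire (f : ℝ → ℂ) =
          fun s ↦ (s - w) ^ n * completedMellinEntire (h : ℝ → ℂ) s from funext hfh]
        exact analyticOrderAt_pow_mul_self hHan n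
      have hHw : completedMellinEntire (h : ℝ → ℂ) w = 0 := by
        rw [← hHan.analyticOrderAt_ne_zero]
        intro h0
        rw [hord, h0, add_zero] at hn
        have : n + 1 ≤ n := by exact_mod_cast hn
        omega
      obtain ⟨h', hh', hdiv⟩ := hdivK h hh w hHw
      have e := completedMellinEntire_eq_mul_of_div ha hh hh' hHw hdiv
      refine ⟨h', hh', fun s ↦ ?_⟩
      rw [hfh s, e s, pow_succ]
      ring

/-! ## G–H. "Suitable linear combinations": minimality from non-completeness -/

/-- **Lemma 7.4 (the mechanism), under the `K_a` clause of Prop. 4.3 at level `a`**: if the evaluators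
of `K_a` (`0 < a`) attached to the multiset `𝒵` are not complete, they are minimal. Printed proof: a
non-zero `f₀ ∈ K_a` with `𝒢_{f₀}` vanishing on `𝒵` (`exists_annihilated`; `𝒢_{f₀} ≢ 0` by
`eq_zero_of_completedMellinEntire_eq_zero`, so its order `N` at `ρ` is finite, `N ≥ m_𝒵(ρ)`); dividing by
`(s−ρ)^{N−j}` (`exists_div_pow`) gives `h_j ∈ K_a` with `𝒢_{h_j}` vanishing EXACTLY to order `j` at `ρ`
(`0 ≤ j < m_𝒵(ρ)`) and still vanishing on the rest of `𝒵`; the continuous pairings `[h_j, ·]` form a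
triangular system against the `Z_{ρ,l}`, `l < m_𝒵(ρ)`, so a suitable combination `ψ`
(`BurnolZetaMinimal.exists_dual_functional`) separates `Z_{ρ,k₀}` from the closed span of all the other
evaluators. [cite: Burnol2004b, Lemma 7.4 and its proof (arXiv:math/0203120v7 p. 18, TeX l.1435–1459)] -/
theorem isMinimalSystem_of_not_isCompleteSystemIn (ha : 0 < a)
    (hdivK : ∀ f ∈ sonineK a, ∀ w : ℂ, completedMellinEntire f w = 0 →
      ∃ h ∈ sonineK a, ∀ s : ℂ, 1 / 2 < s.re → s.re < 1 → s ≠ w →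
        rightMellin h s = rightMellin f s / (s - w))
    (Z : ℂ → ℕ) (hnc : ¬ IsCompleteSystemIn (sonineK a) (sonineZSystem a Z)) :
    IsMinimalSystem (sonineZSystem a Z) := by
  obtain ⟨f₀, hf₀K, hf₀0, hvan⟩ := exists_annihilated ha Z hnc
  intro i hmem
  obtain ⟨⟨ρ, k₀⟩, hk₀⟩ := i
  simp only at hk₀ hmem
  set m := Z ρ with hm
  set F : ℂ → ℂ := completedMellinEntire (f₀ : ℝ → ℂ) with hFdef
  have hF : Differentiable ℂ F := differentiable_completedMellinEntire ha hf₀K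
  -- `𝒢_{f₀} ≢ 0`, so its order at `ρ` is a natural number `N ≥ m`
  have hF0 : F ≠ 0 := fun h ↦
    hf₀0 (eq_zero_of_completedMellinEntire_eq_zero ha hf₀K (fun s ↦ congrFun h s))
  have hNtop : analyticOrderAt F ρ ≠ ⊤ := by
    rw [Ne, AnalyticOnNhd.analyticOrderAt_eq_top_iff_eq_zero ρ (fun z ↦ hF.analyticAt z)]
    exact hF0
  obtain ⟨N, hN⟩ := ENat.ne_top_iff_exists.mp hNtop
  have hvanF : ∀ w : ℂ, (Z w : ℕ∞) ≤ analyticOrderAt F w := fun w ↦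
    (natCast_le_analyticOrderAt_iff_iteratedDeriv_eq_zero (hF.analyticAt w)).mpr
      (fun l hl ↦ hvan ⟨(w, l), hl⟩)
  have hmN : m ≤ N := by
    have h := hvanF ρ
    rw [← hN] at h
    exact_mod_cast h
  -- the divided functions `h_j`, `j < m`: `𝒢_{f₀} = (s − ρ)^{N − j} 𝒢_{h_j}`
  have hdiv : ∀ j : ℕ, ∃ h ∈ sonineK a, j < m → ∀ s,
      F s = (s - ρ) ^ (N - j) * completedMellinEntire (h : ℝ → ℂ) s := by
    intro j
    by_cases hj : j < m
    · obtain ⟨h, hh, hhF⟩ := exists_div_pow ha hdivK hf₀K ρ (N - j)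
        (by rw [← hN]; exact_mod_cast Nat.sub_le N j)
      exact ⟨h, hh, fun _ ↦ hhF⟩
    · exact ⟨f₀, hf₀K, fun h ↦ absurd h hj⟩
  choose h hhK hhF using hdiv
  have hHan : ∀ j (z : ℂ), AnalyticAt ℂ (completedMellinEntire (h j : ℝ → ℂ)) z := fun j z ↦
    (differentiable_completedMellinEntire ha (hhK j)).analyticAt z
  -- orders of `𝒢_{h_j}`: exactly `j` at `ρ`, unchanged (hence `≥ 𝒵(w)`) at `w ≠ ρ`
  have hordρ : ∀ j, j < m → analyticOrderAt (completedMellinEntire (h j : ℝ → ℂ)) ρ = (j : ℕ∞) := by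
    intro j hj
    have e : F = fun s ↦ (s - ρ) ^ (N - j) * completedMellinEntire (h j : ℝ → ℂ) s :=
      funext (hhF j hj)
    have h1 : (N : ℕ∞) = ↑(N - j) + analyticOrderAt (completedMellinEntire (h j : ℝ → ℂ)) ρ := by
      rw [hN, e]
      exact analyticOrderAt_pow_mul_self (hHan j ρ) (N - j)
    rcases ENat.ne_top_iff_exists.mp (show analyticOrderAt (completedMellinEntire (h j : ℝ → ℂ)) ρ ≠ ⊤ by
        intro htop; rw [htop, add_top] at h1; exact ENat.coe_ne_top N h1) with ⟨y, hy⟩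
    rw [← hy] at h1 ⊢
    have : N = (N - j) + y := by exact_mod_cast h1
    have hyj : y = j := by omega
    rw [hyj]
  have hordw : ∀ j, j < m → ∀ w : ℂ, w ≠ ρ →
      (Z w : ℕ∞) ≤ analyticOrderAt (completedMellinEntire (h j : ℝ → ℂ)) w := by
    intro j hj w hw
    have e : F = fun s ↦ (s - ρ) ^ (N - j) * completedMellinEntire (h j : ℝ → ℂ) s :=
      funext (hhF j hj)
    have h1 := hvanF w
    rw [e, analyticOrderAt_pow_mul_of_ne (hHan j w) hw] at h1
    exact h1
  -- derivatives of `𝒢_{h_j}`: the triangular pattern at `ρ`, vanishing on the rest of `𝒵`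
  have hD0 : ∀ j, j < m → ∀ l, l < j → iteratedDeriv l (completedMellinEntire (h j : ℝ → ℂ)) ρ = 0 :=
    fun j hj l hl ↦ (natCast_le_analyticOrderAt_iff_iteratedDeriv_eq_zero (hHan j ρ)).mp
      (hordρ j hj).symm.le l hl
  have hD1 : ∀ j, j < m → iteratedDeriv j (completedMellinEntire (h j : ℝ → ℂ)) ρ ≠ 0 :=
    fun j hj ↦ ((analyticOrderAt_eq_nat_iff_iteratedDeriv_eq_zero (hHan j ρ)).mp (hordρ j hj)).2
  have hDw : ∀ j, j < m → ∀ w : ℂ, w ≠ ρ → ∀ l, l < Z w →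
      iteratedDeriv l (completedMellinEntire (h j : ℝ → ℂ)) w = 0 :=
    fun j hj w hw l hl ↦ (natCast_le_analyticOrderAt_iff_iteratedDeriv_eq_zero (hHan j w)).mp
      (hordw j hj w hw) l hl
  -- the continuous pairings `T_j = [·, h_j] = [h_j, ·]`
  choose T hT using fun j : ℕ ↦ BurnolZetaMinimal.exists_pairingCLM (h j)
  have hTZ : ∀ j (w : ℂ) (l : ℕ),
      T j (sonineZ a w l) = iteratedDeriv l (completedMellinEntire (h j : ℝ → ℂ)) w := by
    intro j w l
    rw [hT, ← setIntegral_mul_sonineZ ha w l (hhK j)]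
    exact integral_congr_ae (Eventually.of_forall fun t ↦ mul_comm _ _)
  -- triangular inversion: `φ_k = T_{m-1-k}`, `v_l = Z_{ρ,l-1}`
  have h0 : ∀ k l, 1 ≤ l → l ≤ m → k + l < m →
      T (m - 1 - k) (sonineZ a ρ (l - 1)) = 0 := by
    intro k l hl hlm hkl
    rw [hTZ]
    exact hD0 (m - 1 - k) (by omega) (l - 1) (by omega)
  have h1 : ∀ k l, 1 ≤ l → l ≤ m → k + l = m →
      T (m - 1 - k) (sonineZ a ρ (l - 1)) ≠ 0 := by
    intro k l hl hlm hkl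
    rw [hTZ, show l - 1 = m - 1 - k by omega]
    exact hD1 (m - 1 - k) (by omega)
  obtain ⟨ψ, hψ0, hψ1, hψ2⟩ :=
    BurnolZetaMinimal.exists_dual_functional (fun k ↦ T (m - 1 - k)) (fun l ↦ sonineZ a ρ (l - 1)) m
      h0 h1 (k₀ + 1) (by omega) (by omega)
  simp only [Nat.add_sub_cancel] at hψ0
  -- `ψ` kills every other evaluator of the system
  have hker : ∀ q : MultisetIndex Z, q ≠ ⟨(ρ, k₀), hk₀⟩ → ψ (sonineZSystem a Z q) = 0 := by
    intro q hq
    obtain ⟨⟨w, l⟩, hl⟩ := q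
    show ψ (sonineZ a w l) = 0
    by_cases heq : w = ρ
    · subst heq
      have hne : l + 1 ≠ k₀ + 1 := by
        intro h'
        apply hq
        have : l = k₀ := by omega
        subst this
        rfl
      have h' := hψ1 (l + 1) (by omega) (by simp only at hl; omega) hne
      simpa only [Nat.add_sub_cancel] using h'
    · refine hψ2 _ fun k hk ↦ ?_
      show T (m - 1 - k) (sonineZ a w l) = 0
      rw [hTZ]
      exact hDw (m - 1 - k) (by omega) w heq l (by simpa using hl)
  -- the closed span of the others lies in `ker ψ`
  have hspan : (Submodule.span ℂ (sonineZSystem a Z '' {j | j ≠ ⟨(ρ, k₀), hk₀⟩}) :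
      Set (Lp ℂ 2 (volume : Measure ℝ))) ⊆ {x | ψ x = 0} := by
    have : Submodule.span ℂ (sonineZSystem a Z '' {j | j ≠ ⟨(ρ, k₀), hk₀⟩}) ≤
        LinearMap.ker (ψ : Lp ℂ 2 (volume : Measure ℝ) →ₗ[ℂ] ℂ) := by
      refine Submodule.span_le.2 ?_
      rintro x ⟨r, hr, rfl⟩
      exact hker r hr
    intro x hx
    exact this hx
  have hcl : closure (Submodule.span ℂ (sonineZSystem a Z '' {j | j ≠ ⟨(ρ, k₀), hk₀⟩}) :
      Set (Lp ℂ 2 (volume : Measure ℝ))) ⊆ {x | ψ x = 0} :=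
    closure_minimal hspan (isClosed_singleton.preimage ψ.continuous)
  exact hψ0 (hcl hmem)

end SonineMultiset

open SonineMultiset in
/-- RH-FREE. **Lemma 7.4 from the `K_a` clause of Prop. 4.3** (division by `s − w` at a zero of
`π^{−w/2}Γ(w/2)G(w)` inside `K̂_a`, for every `a > 0`): "If the system of evaluators associated in a
given `K_a` to a (non-empty) multiset `𝒵` is not complete, then it is minimal." (The non-emptiness and
countability hypotheses of the typed statement are not needed by the argument.)
[cite: Burnol2004b, Lemma 7.4 (arXiv:math/0203120v7 p. 18, TeX l.1435–1459)] -/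
theorem Burnol2004b_lemma7_4_of_divK
    (hdivK : ∀ a : ℝ, 0 < a → ∀ f ∈ sonineK a, ∀ w : ℂ, completedMellinEntire f w = 0 →
      ∃ h ∈ sonineK a, ∀ s : ℂ, 1 / 2 < s.re → s.re < 1 → s ≠ w →
        rightMellin h s = rightMellin f s / (s - w)) :
    Burnol2004b_lemma7_4 :=
  fun Z _ _ a ha hnc ↦ isMinimalSystem_of_not_isCompleteSystemIn ha (hdivK a ha) Z hnc

/-- RH-FREE. **Lemma 7.4 from Prop. 4.3 (`Burnol2004b_prop4_3R`)** — the typed Lemma 7.4 reduced to the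
typed (repaired) Prop. 4.3, of which only the `K_a` clause is used; the hypothesis-free
`Burnol2004b_lemma7_4_holds` is this applied to `Burnol2004b_prop4_3R_holds` once the critical-line case
of Prop. 4.3 is in the tree. [cite: Burnol2004b, Lemma 7.4 and Prop. 4.3 (arXiv:math/0203120v7 pp. 8, 18; TeX l.711–731, 1435–1459)] -/
theorem Burnol2004b_lemma7_4_of_prop4_3R (h : Burnol2004b_prop4_3R) : Burnol2004b_lemma7_4 :=
  Burnol2004b_lemma7_4_of_divK fun a ha ↦ (h a ha).2

/-- RH-FREE. **UNIQUENESS of the evaluator of `K_a` at `(w, k)`** (non-degeneracy of `[·,·]` on the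
conjugation-stable `K_a`; no hypothesis on `a`, `w`, `k`). [cite: Burnol2004b, §7 (arXiv:math/0203120v7 p. 17, TeX l.1382–1389)] -/
theorem IsSonineZ.unique {a : ℝ} {w : ℂ} {k : ℕ} {Z₁ Z₂ : Lp ℂ 2 (volume : Measure ℝ)}
    (h₁ : IsSonineZ a w k Z₁) (h₂ : IsSonineZ a w k Z₂) : Z₁ = Z₂ :=
  BurnolEvaluators.eq_of_pairing_eq (S := sonineK a) (fun _ hf _ hg ↦ BurnolEvaluators.sub_mem_sonineK hf hg)
    (fun c _ hf ↦ smul_mem_sonineK c hf) (fun _ hf ↦ hf.1)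
    (fun _ hu _ hv ↦ BurnolEvaluators.mem_sonineK_of_conj hu hv) h₁.1 h₂.1
    (fun f hf ↦ by rw [h₁.2 f hf, h₂.2 f hf])

/-- RH-FREE. **`sonineZ` is canonical**: any vector with the defining property IS `sonineZ a w k`.
[cite: Burnol2004b, §7 (arXiv:math/0203120v7 p. 17, TeX l.1382–1389)] -/
theorem IsSonineZ.eq_sonineZ {a : ℝ} {w : ℂ} {k : ℕ} {Z : Lp ℂ 2 (volume : Measure ℝ)}
    (h : IsSonineZ a w k Z) : Z = sonineZ a w k :=
  h.unique (Classical.epsilon_spec (p := fun Z ↦ IsSonineZ a w k Z) ⟨Z, h⟩)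

end Literature.NumberTheory.LFunctions
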